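import Summits.AtomisticToContinuum.Crystallization.Theorems.OverbindingBudgetEnergyStraightening

/-!
# OverbindingBudget · decomp-a2c lens-4 g34 — part XXII-N: the site energy of a stacked configuration, LAYER BY LAYER (step DEC of STR)

Helper file under `--supports stmt-AtomisticToContinuum-31280` (RDEF = `Theses.OverbindingBudget.RobustDefectLimitWindows`); closes nothing.

The one analytic leaf left beneath ★ `StackedCellPinningU` after parts XXII-F…M is STR `StraightenedFloor Λ₁` (the straightening argument:
site-energy decomposition DEC → cube averaging AVG → Jensen in the gap heights CONV).  This part PROVES its first step DEC, sorry-free: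

* `layerField_add_lattice`, `layerField_neg` — the layer field `layerField a b v = Σ_{(i,j)} V_LJ ‖v + (i a + j b)‖` is invariant under lattice
  translations of `v` and under `v ↦ −v` (reindexing `ℤ²`);
* `siteMap_injective` — for `a, b` linearly independent, `n` a unit normal and layer heights `⟪w m, n⟫` strictly increasing, the site map
  `(m, i, j) ↦ (i a + j b) + w m` is a bijection `ℤ × ℤ² ≃ Layered a b w` (`range_siteMap`);
* ★ `siteEnergy_layered` — for such a configuration, uniformly discrete, the site energy of EVERY site of layer `m₀` is
  `siteEnergy (Layered a b w) y = Σ'_{m ∈ ℤ} layerField a b (w m − w m₀)` (the `m = m₀` term is the in-plane self field `φ₀ = layerField a b 0`,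
  its `(0,0)` summand being `V_LJ(0) = 0`), the family `m ↦ layerField a b (w m − w m₀)` being summable — by reindexing the absolutely convergent
  site sum (`UniformlyDiscrete.summable_lennardJones`) along the site map and Fubini over `ℤ × ℤ²` (`Summable.tsum_prod'`);
* `siteEnergy_stacked` — the same under STR's binders (`IsUnitNormal a b n`, gap heights `0 < ⟪incr w m, n⟫`, separation `IsSep δ`, `0 < δ`).

What remains of STR for g35 (memo §I): AVG (the mean over a large cube of `Σ'_m layerField a b (w m − w m₀)` is the layer average up to `o(1)`,
pairing `m ≷ m₀` by `layerField_neg`) and CONV (Jensen in the gap heights on the thin band: joint convexity by adjacent dominance, or span-wise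
convex minorants with a certified loss).
-/

noncomputable section

namespace Summit.AtomisticToContinuum.Crystallization.Theorems.OverbindingBudgetEnergySiteDecomposition

open scoped RealInnerProductSpace
open Literature.MathematicalPhysics.StatisticalMechanics (lennardJones lennardJones_zero UniformlyDiscrete)
open Summit.AtomisticToContinuum.Crystallization.Theorems.ChartedPlanarOrderChunkFloor (E3)
open Summit.AtomisticToContinuum.Crystallization.Theorems.ChartedPlanarOrderDensityDichotomy (IsSep)
open Summit.AtomisticToContinuum.Crystallization.Theorems.ChartedPlanarOrderDoorLayered (Layered)
open Summit.AtomisticToContinuum.Crystallization.Theorems.ChartedPlanarOrderProfileSlavingLJ (incr)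
open Summit.AtomisticToContinuum.Crystallization.Theorems.OverbindingBudgetRegistryCut (IsUnitNormal)
open Summit.AtomisticToContinuum.Crystallization.Theorems.OverbindingBudgetEnergyPinningCut (siteEnergy)
open Summit.AtomisticToContinuum.Crystallization.Theorems.OverbindingBudgetEnergyStraightening (layerField)

/-! ## §1 Lattice symmetries of the layer field -/

/-- the layer field is invariant under lattice translations of the offset. [this file] -/
theorem layerField_add_lattice (a b v : E3) (i₀ j₀ : ℤ) :
    layerField a b (v + (((i₀ : ℤ) : ℝ) • a + ((j₀ : ℤ) : ℝ) • b)) = layerField a b v := by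
  unfold layerField
  conv_rhs => rw [← (Equiv.addRight ((i₀, j₀) : ℤ × ℤ)).tsum_eq]
  refine tsum_congr fun ij => ?_
  simp only [Equiv.coe_addRight, Prod.fst_add, Prod.snd_add, Int.cast_add, add_smul]
  congr 2
  abel

/-- the layer field is even in the offset (reindex `(i, j) ↦ (−i, −j)`). [this file] -/
theorem layerField_neg (a b v : E3) : layerField a b (-v) = layerField a b v := by
  unfold layerField
  conv_rhs => rw [← (Equiv.neg (ℤ × ℤ)).tsum_eq]
  refine tsum_congr fun ij => ?_
  simp only [Equiv.neg_apply, Prod.fst_neg, Prod.snd_neg, Int.cast_neg, neg_smul]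
  rw [← norm_neg]
  congr 2
  abel

/-- `layerField a b (u − v) = layerField a b (v − u)`. [this file] -/
theorem layerField_sub_comm (a b u v : E3) : layerField a b (u - v) = layerField a b (v - u) := by
  rw [← layerField_neg, neg_sub]

/-! ## §2 The site map of a stacked configuration -/

/-- the range of the site map `(m, i, j) ↦ (i a + j b) + w m` is the layered configuration. [this file] -/
theorem range_siteMap (a b : E3) (w : ℤ → E3) :
    Set.range (fun p : ℤ × (ℤ × ℤ) => (((p.2.1 : ℤ) : ℝ) • a + ((p.2.2 : ℤ) : ℝ) • b) + w p.1) = Layered a b w := by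
  ext q
  constructor
  · rintro ⟨⟨m, i, j⟩, rfl⟩
    exact ⟨m, i, j, rfl⟩
  · rintro ⟨m, i, j, rfl⟩
    exact ⟨⟨m, i, j⟩, rfl⟩

/-- gap heights positive along `n` ⇒ the layer heights `⟪w m, n⟫` increase strictly. [this file] -/
theorem strictMono_heights {w : ℤ → E3} {n : E3} (hpos : ∀ m : ℤ, 0 < ⟪incr w m, n⟫) : StrictMono fun m : ℤ => ⟪w m, n⟫ := by
  refine strictMono_int_of_lt_succ fun m => ?_
  have h := hpos (m + 1)
  simp only [incr, add_sub_cancel_right, inner_sub_left] at h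
  simpa using h

/-- the site map is injective: distinct layers have distinct heights along the normal, and within a layer the lattice coordinates are
determined (`a, b` linearly independent). [this file] -/
theorem siteMap_injective {a b n : E3} {w : ℤ → E3} (hab : LinearIndependent ℝ ![a, b]) (hn : IsUnitNormal a b n)
    (hmono : StrictMono fun m : ℤ => ⟪w m, n⟫) :
    Function.Injective (fun p : ℤ × (ℤ × ℤ) => (((p.2.1 : ℤ) : ℝ) • a + ((p.2.2 : ℤ) : ℝ) • b) + w p.1) := by
  rintro ⟨m, i, j⟩ ⟨m', i', j'⟩ h
  simp only at h
  have ha : ⟪a, n⟫ = 0 := by rw [real_inner_comm]; exact hn.2.1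
  have hb : ⟪b, n⟫ = 0 := by rw [real_inner_comm]; exact hn.2.2
  have hh : ⟪w m, n⟫ = ⟪w m', n⟫ := by
    have := congrArg (fun z : E3 => ⟪z, n⟫) h
    simpa [inner_add_left, inner_smul_left, ha, hb] using this
  obtain rfl : m = m' := hmono.injective hh
  have hl : ((i : ℤ) : ℝ) • a + ((j : ℤ) : ℝ) • b = ((i' : ℤ) : ℝ) • a + ((j' : ℤ) : ℝ) • b := add_right_cancel h
  obtain ⟨hi, hj⟩ := hab.eq_of_pair hl
  obtain rfl : i = i' := by exact_mod_cast hi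
  obtain rfl : j = j' := by exact_mod_cast hj
  rfl

/-! ## §3 ★ The decomposition -/

/-- ★ **DEC.** For `a, b` linearly independent, `n` a unit normal to both, layer heights strictly increasing along `n` and `Layered a b w` uniformly
discrete, the site energy of the site `(i₀ a + j₀ b) + w m₀` of layer `m₀` is the (summable) sum over ALL layers `m` of the layer fields at the
relative offsets `w m − w m₀` — independent of the site within the layer. [this file] -/
theorem siteEnergy_layered {a b n : E3} {w : ℤ → E3} (hab : LinearIndependent ℝ ![a, b]) (hn : IsUnitNormal a b n)
    (hmono : StrictMono fun m : ℤ => ⟪w m, n⟫) (hUD : UniformlyDiscrete (Layered a b w)) (m₀ i₀ j₀ : ℤ) :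
    Summable (fun m : ℤ => layerField a b (w m - w m₀)) ∧
      siteEnergy (Layered a b w) ((((i₀ : ℤ) : ℝ) • a + ((j₀ : ℤ) : ℝ) • b) + w m₀) = ∑' m : ℤ, layerField a b (w m - w m₀) := by
  classical
  set Y : Set E3 := Layered a b w with hY
  set y : E3 := (((i₀ : ℤ) : ℝ) • a + ((j₀ : ℤ) : ℝ) • b) + w m₀ with hy
  set φ : ℤ × (ℤ × ℤ) → E3 := fun p => (((p.2.1 : ℤ) : ℝ) • a + ((p.2.2 : ℤ) : ℝ) • b) + w p.1 with hφ
  have hinj : Function.Injective φ := siteMap_injective hab hn hmono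
  have hrange : Set.range φ = Y := range_siteMap a b w
  set f : E3 → ℝ := fun q => lennardJones (dist y q) with hf
  have hfy : f y = 0 := by simp [hf, lennardJones_zero]
  -- (1) the diagonal term vanishes: the site sum over `Y ∖ {y}` is the sum over `Y`
  have h1 : siteEnergy Y y = ∑' q : ↥Y, f q := by
    have hE : siteEnergy Y y = ∑' q : ↥(Y \ {y}), f q := rfl
    rw [hE, tsum_subtype (Y \ {y}) f, tsum_subtype Y f]
    refine tsum_congr fun q => ?_
    by_cases hq : q = y
    · subst hq
      simp [Set.indicator_apply, hfy]
    · simp [Set.indicator_apply, hq]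
  -- (2) reindex along the site map
  have hSY : Summable (fun q : ↥Y => f q) := hUD.summable_lennardJones y
  have hmem : ∀ p : ℤ × (ℤ × ℤ), φ p ∈ Y := fun p => hrange ▸ ⟨p, rfl⟩
  have hSφ : Summable (fun p : ℤ × (ℤ × ℤ) => f (φ p)) := by
    have := hSY.comp_injective (i := fun p : ℤ × (ℤ × ℤ) => (⟨φ p, hmem p⟩ : ↥Y))
      (fun p q h => hinj (congrArg Subtype.val h))
    exact this
  have h2 : ∑' q : ↥Y, f q = ∑' p : ℤ × (ℤ × ℤ), f (φ p) := by
    rw [← tsum_congr_set_coe f hrange, tsum_range f hinj]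
  -- (3) the summands, layer by layer
  have hterm : ∀ p : ℤ × (ℤ × ℤ), f (φ p) = lennardJones ‖(w p.1 - y) + ((((p.2.1 : ℤ)) : ℝ) • a + (((p.2.2 : ℤ)) : ℝ) • b)‖ := by
    intro p
    simp only [hf, hφ, dist_eq_norm]
    rw [← norm_neg]
    congr 2
    abel
  -- (4) Fubini over `ℤ × ℤ²`
  have hfib : ∀ m : ℤ, Summable fun ij : ℤ × ℤ => f (φ (m, ij)) := fun m => hSφ.prod_factor m
  have h4 : ∑' p : ℤ × (ℤ × ℤ), f (φ p) = ∑' m : ℤ, ∑' ij : ℤ × ℤ, f (φ (m, ij)) := hSφ.tsum_prod' hfib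
  -- (5) the inner sums are the layer fields
  have hshift : ∀ m : ℤ, w m - y = (w m - w m₀) + ((((-i₀ : ℤ)) : ℝ) • a + (((-j₀ : ℤ)) : ℝ) • b) := by
    intro m
    simp only [hy, Int.cast_neg, neg_smul]
    abel
  have hinner : ∀ m : ℤ, ∑' ij : ℤ × ℤ, f (φ (m, ij)) = layerField a b (w m - w m₀) := by
    intro m
    simp_rw [hterm]
    show layerField a b (w m - y) = _
    rw [hshift, layerField_add_lattice]
  refine ⟨(hSφ.prod).congr hinner, ?_⟩
  rw [h1, h2, h4]
  exact tsum_congr hinner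

/-- **DEC under STR's binders**: `n` a unit normal, gap heights `⟪incr w m, n⟫ > 0`, separation `IsSep δ` with `δ > 0`. [this file] -/
theorem siteEnergy_stacked {a b n : E3} {w : ℤ → E3} {δ : ℝ} (hδ : 0 < δ) (hab : LinearIndependent ℝ ![a, b])
    (hsep : IsSep δ (Layered a b w)) (hn : IsUnitNormal a b n) (hpos : ∀ m : ℤ, 0 < ⟪incr w m, n⟫) (m₀ i₀ j₀ : ℤ) :
    Summable (fun m : ℤ => layerField a b (w m - w m₀)) ∧
      siteEnergy (Layered a b w) ((((i₀ : ℤ) : ℝ) • a + ((j₀ : ℤ) : ℝ) • b) + w m₀) = ∑' m : ℤ, layerField a b (w m - w m₀) :=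
  siteEnergy_layered hab hn (strictMono_heights hpos) ⟨δ, hδ, hsep⟩ m₀ i₀ j₀

/-- **all sites of a layer have the same energy.** [this file] -/
theorem siteEnergy_layer_const {a b n : E3} {w : ℤ → E3} {δ : ℝ} (hδ : 0 < δ) (hab : LinearIndependent ℝ ![a, b])
    (hsep : IsSep δ (Layered a b w)) (hn : IsUnitNormal a b n) (hpos : ∀ m : ℤ, 0 < ⟪incr w m, n⟫) (m₀ i₀ j₀ : ℤ) :
    siteEnergy (Layered a b w) ((((i₀ : ℤ) : ℝ) • a + ((j₀ : ℤ) : ℝ) • b) + w m₀) = siteEnergy (Layered a b w) (w m₀) := by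
  rw [(siteEnergy_stacked hδ hab hsep hn hpos m₀ i₀ j₀).2]
  have h0 := (siteEnergy_stacked hδ hab hsep hn hpos m₀ 0 0).2
  simp only [Int.cast_zero, zero_smul, add_zero, zero_add] at h0
  rw [h0]

end Summit.AtomisticToContinuum.Crystallization.Theorems.OverbindingBudgetEnergySiteDecomposition

end
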